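import Literature.NumberTheory.Transcendental.WeakCITSchanuel
import Literature.NumberTheory.Transcendental.WeakCITUltraproduct
import Literature.NumberTheory.Transcendental.WeakCITLogPoint
import HarnessLib

/-!
# Weak CIT, step 5a: the compactness argument

Support file for the discharge of `Literature.NumberTheory.Transcendental.weakCIT`
(`IntersectionsWithTori.lean`). This is the "uniform Schanuel property" step of Kirby 2009
(Thm 4.3: Ax's theorem in every differential field + compactness ⟹ the subgroup witnessing an
atypical intersection can be taken from a finite list), carried out with the explicit ultraproduct
of `WeakCITUltraproduct.lean` instead of first-order compactness.

**`exists_int_relation_of_family`.** Let `(L_k)_{k ∈ ℕ}` be logarithmic points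
(`WeakCITLogPoint.lean`: fields `F_k ⊇ ℂ` with derivations `D_{k,j}`, exponential pairs
`(x_k, y_k)`, `y_k` generic in a prime `P_k ⊇ I` of dimension `|S_k|`), and for each `k` let
`U_k, U'_k` be integer matrices with `U'_k U_k = 1` and `J_k` indices such that the new logarithms
`x'_{k,j} = Σᵢ U_{k,ji} x_{k,i}`, `j ∈ J_k`, are constants of the `D_{k,·}`, with
`dim Z(I) < |S_k| + |J_k|` for all `k`. Then there is ONE non-zero integer vector `q` such that for
infinitely many `k` the Laurent monomial `∏ᵢ y_{k,i}^{qᵢ}` is a constant of all the `D_{k,j}`.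
Proof: pigeonhole `(S_k, J_k)` along a non-principal ultrafilter `𝒰` on `ℕ`, pass to the
ultraproduct `F = Π_𝒰 F_k` with the componentwise derivations (Łoś for the finitely many atomic
hypotheses), apply the one-field Schanuel bound `WeakCIT.exists_int_relation`
(`WeakCITSchanuel.lean`, from Ax's theorem) to get `q`, and transfer
`D_j (∏ yᵢ^{qᵢ}) = (∏ yᵢ^{qᵢ}) D_j(Σ qᵢ xᵢ) = 0` back to `𝒰`-many, hence infinitely many, `k`.

## References

* J. Kirby, *The theory of the exponential differential equations of semiabelian varieties*,
  Selecta Math. 15 (2009) 445–486, Thm 4.3 and proof of Thm 4.6.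
* B. Zilber, *Exponential sums equations and the Schanuel conjecture*, J. London Math. Soc. (2)
  65 (2002) 27–44, Thm 2 ⟹ Cor. 3.
-/

noncomputable section

open MvPolynomial Set Filter

namespace Literature.NumberTheory.Transcendental.WeakCIT

variable {n : ℕ}

/-- Logarithmic derivative of a Laurent monomial along an exponential pair: if `D yᵢ = yᵢ D xᵢ`
(`yᵢ ≠ 0`) then `D (∏ yᵢ^{wᵢ}) = (∏ yᵢ^{wᵢ}) · D (Σ wᵢ xᵢ)` (from the tree's
`inv_mul_derivation_prod_zpow`); in particular `∏ yᵢ^{wᵢ}` is a constant as soon as `Σ wᵢ xᵢ`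
is. [folklore] -/
theorem derivation_prod_zpow_eq_zero {R L : Type*} [CommRing R] [Field L] [Algebra R L]
    (D : Derivation R L L) (x y : Fin n → L) (hy : ∀ i, y i ≠ 0)
    (hD : ∀ i, D (y i) = y i * D (x i)) (w : Fin n → ℤ) (hw : D (∑ i, (w i : L) * x i) = 0) :
    D (∏ i, y i ^ w i) = 0 := by
  have hP : (∏ i, y i ^ w i) ≠ 0 :=
    Finset.prod_ne_zero_iff.mpr fun i _ => zpow_ne_zero _ (hy i)
  have h := inv_mul_derivation_prod_zpow D Finset.univ y (fun i _ => hy i) w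
  rw [inv_mul_eq_iff_eq_mul₀ hP] at h
  have hsum : ∑ i, (w i : L) * ((y i)⁻¹ * D (y i)) = D (∑ i, (w i : L) * x i) := by
    rw [map_sum]
    refine Finset.sum_congr rfl fun i _ => ?_
    rw [Derivation.leibniz, D.map_intCast, smul_zero, add_zero, smul_eq_mul, hD i,
      inv_mul_cancel_left₀ (hy i)]
  rw [h, hsum, hw, mul_zero]

/-- `U' (U x) = x` for mutually inverse integer matrices acting on a tuple of field elements.
[folklore] -/
theorem sum_cast_mul_sum_cast_mul {L : Type*} [Field L] {U U' : Matrix (Fin n) (Fin n) ℤ}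
    (hU'U : U' * U = 1) (x : Fin n → L) (i : Fin n) :
    ∑ l, (U' i l : L) * ∑ l', (U l l' : L) * x l' = x i := by
  classical
  calc ∑ l, (U' i l : L) * ∑ l', (U l l' : L) * x l'
      = ∑ l', (∑ l, (U' i l : L) * (U l l' : L)) * x l' := by
        simp_rw [Finset.mul_sum, ← mul_assoc]
        rw [Finset.sum_comm]
        simp_rw [Finset.sum_mul]
    _ = ∑ l', (((U' * U) i l' : ℤ) : L) * x l' := by
        refine Finset.sum_congr rfl fun l' _ => ?_
        rw [Matrix.mul_apply]
        push_cast
        rfl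
    _ = x i := by
        rw [hU'U]
        simp [Matrix.one_apply, Finset.sum_ite_eq]

/-- **The compactness step of weak CIT** (Kirby 2009, Thm 4.3, via an ultraproduct and the
one-field Schanuel bound). See the module docstring for the statement.
[cite: Kirby2009, Thm 4.3 and Thm 4.6 (proof)] -/
theorem exists_int_relation_of_family (L : ℕ → LogPoint n)
    (U U' : ℕ → Matrix (Fin n) (Fin n) ℤ) (J : ℕ → Finset (Fin n))
    (I : Ideal (MvPolynomial (Fin n) ℂ)) [I.IsPrime] (d : ℕ)
    (hd : ringKrullDim (MvPolynomial (Fin n) ℂ ⧸ I) = d)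
    (hU'U : ∀ k, U' k * U k = 1)
    (hI : ∀ k, I ≤ (L k).P)
    (hrel : ∀ k, ∀ j ∈ J k, ∀ l, (L k).D l (∑ i, (U k j i : (L k).F) * (L k).x i) = 0)
    (hlt : ∀ k, d < (L k).S.card + (J k).card) :
    ∃ q : Fin n → ℤ, q ≠ 0 ∧ ∀ N : ℕ, ∃ k, N ≤ k ∧ ∀ j, (L k).D j (∏ i, (L k).y i ^ q i) = 0 := by
  classical
  -- a non-principal ultrafilter and the pigeonhole on `(S_k, J_k)`
  set 𝒰 : Ultrafilter ℕ := hyperfilter ℕ with h𝒰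
  obtain ⟨⟨S₀, J₀⟩, -, hA₀⟩ := (Ultrafilter.finite_biUnion_mem_iff (f := 𝒰)
    (is := (Set.univ : Set (Finset (Fin n) × Finset (Fin n))))
    (s := fun p => {k | (L k).S = p.1 ∧ J k = p.2}) Set.finite_univ).mp (by
      have : (⋃ p ∈ (Set.univ : Set (Finset (Fin n) × Finset (Fin n))),
          {k | (L k).S = p.1 ∧ J k = p.2}) = Set.univ := by
        ext k
        simp only [Set.mem_iUnion, Set.mem_univ, Set.mem_setOf_eq, exists_prop, true_and, iff_true]
        exact ⟨((L k).S, J k), rfl, rfl⟩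
      rw [this]
      exact univ_mem)
  -- the ultraproduct and the transferred data
  let Fam : ℕ → Type := fun k => (L k).F
  let Fs : Type := Ultraproduct Fam 𝒰
  let xs : Fin n → Fs := fun i => mk Fam 𝒰 fun k => (L k).x i
  let ys : Fin n → Fs := fun i => mk Fam 𝒰 fun k => (L k).y i
  let x's : Fin n → Fs := fun i => mk Fam 𝒰 fun k => ∑ l, (U k i l : (L k).F) * (L k).x l
  let Us : Matrix (Fin n) (Fin n) Fs := Matrix.of fun i l => mk Fam 𝒰 fun k => (U k i l : (L k).F)
  let U's : Matrix (Fin n) (Fin n) Fs := Matrix.of fun i l => mk Fam 𝒰 fun k => (U' k i l : (L k).F)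
  let Ds : Fin n → Derivation ℤ Fs Fs := fun j =>
    liftDerivation (F := Fam) (U := 𝒰) fun k => ((L k).D j).restrictScalars ℤ
  have hDs_mk : ∀ j (f : ∀ k, Fam k), Ds j (mk Fam 𝒰 f) = mk Fam 𝒰 fun k => (L k).D j (f k) :=
    fun j f => rfl
  -- hypotheses of the one-field Schanuel bound
  have hD : ∀ j (c : ℂ), Ds j (algebraMap ℂ Fs c) = 0 := fun j c => by
    rw [algebraMap_eq_mk, hDs_mk, mk_eq_zero_iff]
    exact Eventually.of_forall fun k => Derivation.map_algebraMap _ c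
  have hcastD : ∀ k j (z : ℤ), (L k).D j (z : (L k).F) = 0 := fun k j z => by
    rw [← map_intCast (algebraMap ℂ (L k).F) z]
    exact Derivation.map_algebraMap _ _
  have hU : ∀ j i l, Ds j (Us i l) = 0 := fun j i l => by
    show Ds j (mk Fam 𝒰 fun k => (U k i l : (L k).F)) = 0
    rw [hDs_mk, mk_eq_zero_iff]
    exact Eventually.of_forall fun k => hcastD k j _
  have hU' : ∀ j i l, Ds j (U's i l) = 0 := fun j i l => by
    show Ds j (mk Fam 𝒰 fun k => (U' k i l : (L k).F)) = 0
    rw [hDs_mk, mk_eq_zero_iff]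
    exact Eventually.of_forall fun k => hcastD k j _
  have hx' : ∀ i, x's i = ∑ l, Us i l * xs l := fun i => by
    show x's i = ∑ l, mk Fam 𝒰 (fun k => (U k i l : (L k).F)) * mk Fam 𝒰 (fun k => (L k).x l)
    rw [sum_mk_mul_mk]
  have hx : ∀ i, xs i = ∑ l, U's i l * x's l := fun i => by
    show xs i = ∑ l, mk Fam 𝒰 (fun k => (U' k i l : (L k).F)) *
      mk Fam 𝒰 (fun k => ∑ l', (U k l l' : (L k).F) * (L k).x l')
    rw [sum_mk_mul_mk]
    show mk Fam 𝒰 (fun k => (L k).x i) = _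
    congr 1
    funext k
    exact (sum_cast_mul_sum_cast_mul (hU'U k) (L k).x i).symm
  have hJ : ∀ i ∈ J₀, ∀ j, Ds j (x's i) = 0 := fun i hi j => by
    show Ds j (mk Fam 𝒰 fun k => ∑ l, (U k i l : (L k).F) * (L k).x l) = 0
    rw [hDs_mk, mk_eq_zero_iff]
    refine mem_of_superset hA₀ fun k hk => ?_
    exact hrel k i (hk.2 ▸ hi) j
  have hS : ∀ i ∈ S₀, ∀ j, Ds j (xs i) = if i = j then 1 else 0 := fun i hi j => by
    show Ds j (mk Fam 𝒰 fun k => (L k).x i) = _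
    rw [hDs_mk]
    have : (if i = j then (1 : Fs) else 0) = mk Fam 𝒰 fun k => if i = j then 1 else 0 := by
      split_ifs
      · exact (map_one (mk Fam 𝒰)).symm
      · exact (map_zero (mk Fam 𝒰)).symm
    rw [this, mk_eq_mk_iff]
    refine mem_of_superset hA₀ fun k hk => ?_
    exact (L k).map_x i (hk.1 ▸ hi) j
  have hy : ∀ i, ys i ≠ 0 := fun i => by
    show mk Fam 𝒰 (fun k => (L k).y i) ≠ 0
    rw [mk_ne_zero_iff]
    exact Eventually.of_forall fun k => (L k).y_ne_zero i
  have hexp : ∀ j i, Ds j (ys i) = ys i * Ds j (xs i) := fun j i => by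
    show Ds j (mk Fam 𝒰 fun k => (L k).y i) = mk Fam 𝒰 (fun k => (L k).y i) * Ds j (mk Fam 𝒰 fun k => (L k).x i)
    rw [hDs_mk, hDs_mk, ← map_mul]
    congr 1
    funext k
    exact (L k).map_y j i
  have hIy : ∀ p ∈ I, aeval ys p = 0 := fun p hp => by
    show aeval (fun i => mk Fam 𝒰 fun k => (L k).y i) p = 0
    rw [aeval_mk, mk_eq_zero_iff]
    exact Eventually.of_forall fun k => ((L k).aeval_eq_zero_iff p).mpr (hI k hp)
  have hdim : zariskiDim ℂ (zeroLocus ℂ I) ≤ d := by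
    rw [zariskiDim_zeroLocus_eq, hd]
  obtain ⟨k₀, hk₀⟩ := 𝒰.nonempty_of_mem hA₀
  have hlt₀ : d < S₀.card + J₀.card := by
    have := hlt k₀
    rw [hk₀.1, hk₀.2] at this
    exact this
  -- the one-field Schanuel bound in the ultraproduct
  obtain ⟨q, hq0, hq⟩ := exists_int_relation Ds hD xs ys x's Us U's hU hU' hx' hx J₀ hJ S₀ hS hy
    hexp I hIy hdim hlt₀
  refine ⟨q, hq0, fun N => ?_⟩
  -- transfer back: `D_j (∏ y^q) = (∏ y^q) D_j (Σ qᵢ xᵢ) = 0` in `F`, hence `𝒰`-often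
  have hprod : ∀ j, Ds j (∏ i, ys i ^ q i) = 0 := fun j =>
    derivation_prod_zpow_eq_zero (Ds j) xs ys hy (hexp j) q (hq j)
  have hev : ∀ᶠ k in (𝒰 : Filter ℕ), ∀ j, (L k).D j (∏ i, (L k).y i ^ q i) = 0 := by
    have h := (forall_liftDerivation_mk_eq_zero_iff (F := Fam) (U := 𝒰)
      (fun k j => ((L k).D j).restrictScalars ℤ) (fun k => ∏ i, (L k).y i ^ q i)).mp (fun j => by
        have := hprod j
        rwa [show (∏ i, ys i ^ q i) = mk Fam 𝒰 (fun k => ∏ i, (L k).y i ^ q i) from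
          prod_mk_zpow (F := Fam) (U := 𝒰) (fun k i => (L k).y i) q] at this)
    exact h.mono fun k hk j => hk j
  have hN : ∀ᶠ k in (𝒰 : Filter ℕ), N ≤ k :=
    (hyperfilter_le_cofinite.trans_eq Nat.cofinite_eq_atTop) (eventually_ge_atTop N)
  obtain ⟨k, hk, hkN⟩ := 𝒰.nonempty_of_mem (inter_mem hev hN)
  exact ⟨k, hkN, hk⟩

end Literature.NumberTheory.Transcendental.WeakCIT
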